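import Summits.PneNP.PneNP.Theorems.KarlinRubinMonotoneSufficesGreedyCount
import Mathlib.Data.Fintype.CardEmbedding

/-!
# Crux `MonotoneSuffices` (stmt-PneNP-18026), the GREEDY general detector — part 2: threading a clique

Fix an input `x` and a clique `A` of `x` (in the application: the planted set). A trial THREADS `A` along an
injective sequence `u : Fin t → A` if at every level `i` the first candidate in the pool of the picks
`{u 0, …, u (i-1)}` is `u i`; then its run ends with the `t`-subset `{u 0, …, u (t-1)} ⊆ A` (`run_eq_of_thread`).
The threading tables form a PRODUCT set over the levels (`card_thread`), distinct sequences thread disjoint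
sets of tables (`disjoint_thread`), and part 1 bounds each factor from below. Summing over the
`≥ (#A+1-t)^t` injective sequences (`descFactorial_le_card_injective`):

* `card_runs_into_mul_ge` — `(#A+1-t)^t · (n^M)^t ≤ #{c : the run of c succeeds inside A} · ∏_{i<t} (2 B i)`
  whenever every pool of an `i`-subset `T ⊆ A` (`i < t`) has at most `B i` and at least `n/M` elements and
  contains `A ∖ T`.

Finite combinatorics only.
-/

set_option linter.dupNamespace false -- `Summit.PneNP.PneNP.…`: summit = sub-problem name (D-0017 single-conjunct layout)

namespace Summit.PneNP.PneNP.Theorems.MonotoneSuffices.Greedy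

open Finset
open Literature.Probability.RandomGraphs.PlantedClique

variable {n t M : ℕ}

/-! ### Prefix sets of a sequence -/

/-- Membership in the set of the first `i` values of `u`. [folklore] -/
theorem mem_image_prefix (u : Fin t → Fin n) (i : ℕ) (v : Fin n) :
    v ∈ (univ.filter fun j : Fin t => j.1 < i).image u ↔ ∃ j : Fin t, j.1 < i ∧ u j = v := by
  simp

/-- No values before level `0`. [folklore] -/
theorem image_prefix_zero (u : Fin t → Fin n) : (univ.filter fun j : Fin t => j.1 < 0).image u = ∅ := by
  ext v; simp

/-- The prefix sets grow by one value at a time. [folklore] -/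
theorem image_prefix_succ (u : Fin t → Fin n) (i : Fin t) :
    (univ.filter fun j : Fin t => j.1 < i.1 + 1).image u =
      insert (u i) ((univ.filter fun j : Fin t => j.1 < i.1).image u) := by
  ext v
  simp only [mem_image, mem_filter, mem_univ, true_and, mem_insert]
  constructor
  · rintro ⟨j, hj, rfl⟩
    rcases Nat.lt_succ_iff_lt_or_eq.1 hj with h | h
    · exact Or.inr ⟨j, h, rfl⟩
    · exact Or.inl (by rw [Fin.ext h])
  · rintro (rfl | ⟨j, hj, rfl⟩)
    · exact ⟨i, Nat.lt_succ_self _, rfl⟩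
    · exact ⟨j, Nat.lt_succ_of_lt hj, rfl⟩

/-- All `t` values. [folklore] -/
theorem image_prefix_self (u : Fin t → Fin n) : (univ.filter fun j : Fin t => j.1 < t).image u = univ.image u := by
  congr 1; ext j; simp

/-- The prefix sets of a sequence with values in `A` lie in `A`. [folklore] -/
theorem image_prefix_subset {u : Fin t → Fin n} {A : Finset (Fin n)} (hA : ∀ j, u j ∈ A) (i : ℕ) :
    (univ.filter fun j : Fin t => j.1 < i).image u ⊆ A := by
  intro v hv
  obtain ⟨j, -, rfl⟩ := (mem_image_prefix u i v).1 hv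
  exact hA j

/-- An injective sequence does not repeat an earlier value. [folklore] -/
theorem not_mem_image_prefix {u : Fin t → Fin n} (hu : Function.Injective u) (i : Fin t) :
    u i ∉ (univ.filter fun j : Fin t => j.1 < i.1).image u := by
  intro h
  obtain ⟨j, hj, hji⟩ := (mem_image_prefix u i.1 (u i)).1 h
  have := hu hji
  subst this
  exact lt_irrefl _ hj

/-- The first `i ≤ t` values of an injective sequence form an `i`-set. [folklore] -/
theorem card_image_prefix {u : Fin t → Fin n} (hu : Function.Injective u) {i : ℕ} (hi : i ≤ t) :
    #((univ.filter fun j : Fin t => j.1 < i).image u) = i := by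
  rw [card_image_of_injective _ hu]
  have h : ((univ.filter fun j : Fin t => j.1 < i).image fun j : Fin t => j.1) = range i := by
    ext v
    simp only [mem_image, mem_filter, mem_univ, true_and, mem_range]
    constructor
    · rintro ⟨j, hj, rfl⟩; exact hj
    · intro hv; exact ⟨⟨v, lt_of_lt_of_le hv hi⟩, hv, rfl⟩
  calc #(univ.filter fun j : Fin t => j.1 < i)
      = #((univ.filter fun j : Fin t => j.1 < i).image fun j : Fin t => j.1) :=
        (card_image_of_injective _ Fin.val_injective).symm
    _ = #(range i) := by rw [h]
    _ = i := card_range i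

/-! ### Threading -/

/-- **A threading table runs along the sequence**: if at every level the first candidate in the pool of the
earlier values is the next value, the run after `i ≤ t` levels is the set of the first `i` values. [folklore] -/
theorem run_eq_of_thread (x : EdgeVec n) (c : Fin t → Fin M → Fin n) (u : Fin t → Fin n)
    (h : ∀ i : Fin t, firstHit (c i) (pool x ((univ.filter fun j : Fin t => j.1 < i.1).image u)) = some (u i)) :
    ∀ {i : ℕ}, i ≤ t → run x c i = some ((univ.filter fun j : Fin t => j.1 < i).image u)
  | 0, _ => by rw [run_zero, image_prefix_zero]
  | i + 1, hi => by
      have hit : i < t := hi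
      rw [run_succ_of_lt x c hit, run_eq_of_thread x c u h (le_of_lt hit), Option.bind_some, h ⟨i, hit⟩,
        Option.map_some, image_prefix_succ u ⟨i, hit⟩]

/-- The threading tables of a sequence form a product set over the levels. [folklore] -/
theorem filter_thread_eq_piFinset (x : EdgeVec n) (u : Fin t → Fin n) :
    ((univ : Finset (Fin t → Fin M → Fin n)).filter fun c =>
      ∀ i : Fin t, firstHit (c i) (pool x ((univ.filter fun j : Fin t => j.1 < i.1).image u)) = some (u i)) =
      Fintype.piFinset fun i : Fin t => (univ : Finset (Fin M → Fin n)).filter fun ci =>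
        firstHit ci (pool x ((univ.filter fun j : Fin t => j.1 < i.1).image u)) = some (u i) := by
  ext c
  simp only [mem_filter, mem_univ, true_and, Fintype.mem_piFinset]

/-- **The number of threading tables is the product of the level counts.** [folklore] -/
theorem card_thread (x : EdgeVec n) (u : Fin t → Fin n) :
    #((univ : Finset (Fin t → Fin M → Fin n)).filter fun c =>
      ∀ i : Fin t, firstHit (c i) (pool x ((univ.filter fun j : Fin t => j.1 < i.1).image u)) = some (u i)) =
      ∏ i : Fin t, #((univ : Finset (Fin M → Fin n)).filter fun ci =>
        firstHit ci (pool x ((univ.filter fun j : Fin t => j.1 < i.1).image u)) = some (u i)) := by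
  rw [filter_thread_eq_piFinset, Fintype.card_piFinset]

/-- A table threads at most one sequence. [folklore] -/
theorem eq_of_thread (x : EdgeVec n) (c : Fin t → Fin M → Fin n) {u u' : Fin t → Fin n}
    (h : ∀ i : Fin t, firstHit (c i) (pool x ((univ.filter fun j : Fin t => j.1 < i.1).image u)) = some (u i))
    (h' : ∀ i : Fin t, firstHit (c i) (pool x ((univ.filter fun j : Fin t => j.1 < i.1).image u')) = some (u' i)) :
    u = u' := by
  suffices hind : ∀ k : ℕ, ∀ i : Fin t, i.1 < k → u i = u' i from funext fun i => hind (i.1 + 1) i (Nat.lt_succ_self _)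
  intro k
  induction k with
  | zero => intro i hi; exact absurd hi (Nat.not_lt_zero _)
  | succ k ih =>
      intro i hi
      have hpre : (univ.filter fun j : Fin t => j.1 < i.1).image u = (univ.filter fun j : Fin t => j.1 < i.1).image u' := by
        ext v
        simp only [mem_image_prefix]
        constructor
        · rintro ⟨j, hj, rfl⟩; exact ⟨j, hj, (ih j (by omega)).symm⟩
        · rintro ⟨j, hj, rfl⟩; exact ⟨j, hj, ih j (by omega)⟩
      have h1 := h i
      rw [hpre, h' i] at h1
      exact (Option.some_injective _ h1).symm

/-- Distinct sequences thread disjoint sets of tables. [folklore] -/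
theorem disjoint_thread (x : EdgeVec n) {u u' : Fin t → Fin n} (huu' : u ≠ u') :
    Disjoint
      ((univ : Finset (Fin t → Fin M → Fin n)).filter fun c =>
        ∀ i : Fin t, firstHit (c i) (pool x ((univ.filter fun j : Fin t => j.1 < i.1).image u)) = some (u i))
      ((univ : Finset (Fin t → Fin M → Fin n)).filter fun c =>
        ∀ i : Fin t, firstHit (c i) (pool x ((univ.filter fun j : Fin t => j.1 < i.1).image u')) = some (u' i)) := by
  rw [disjoint_filter]
  intro c _ h h'
  exact huu' (eq_of_thread x c h h')

/-! ### Counting injective sequences into `A` -/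

/-- There are at least `(#A).descFactorial t ≥ (#A+1-t)^t` injective sequences `Fin t → A`. [folklore] -/
theorem descFactorial_le_card_injective (A : Finset (Fin n)) (t : ℕ) :
    (#A + 1 - t) ^ t ≤ #((univ : Finset (Fin t → Fin n)).filter fun u => Function.Injective u ∧ ∀ j, u j ∈ A) := by
  classical
  refine (Nat.pow_sub_le_descFactorial (#A) t).trans ?_
  have h1 : Fintype.card (Fin t ↪ A) = (#A).descFactorial t := by
    rw [Fintype.card_embedding_eq, Fintype.card_coe, Fintype.card_fin]
  rw [← h1, ← Fintype.card_coe]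
  refine Fintype.card_le_of_injective
    (fun e => ⟨fun i => (e i).1, mem_filter.2 ⟨mem_univ _, fun i j hij => e.injective (Subtype.ext hij),
      fun j => (e j).2⟩⟩) ?_
  intro e e' hee'
  have h := congrArg Subtype.val hee'
  ext i
  exact congrArg Fin.val (congrFun h i)

/-! ### The lower bound on the tables whose run succeeds inside `A` -/

/-- **Threading count.** Let `A` be such that for every `T ⊆ A` with `#T < t` the pool of `T` contains `A ∖ T`,
has at most `B #T` elements and at least `n/M` elements. Then
`(#A+1-t)^t · (n^M)^t ≤ #{c : ∃ T ⊆ A, run x c t = some T} · ∏_{i<t} (2 B i)`. [folklore] -/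
theorem card_runs_into_mul_ge (x : EdgeVec n) (A : Finset (Fin n)) (B : ℕ → ℕ)
    (hclique : ∀ T ⊆ A, ∀ v ∈ A, v ∉ T → v ∈ pool x T)
    (hB : ∀ T ⊆ A, #T < t → #(pool x T) ≤ B #T)
    (hM : ∀ T ⊆ A, #T < t → n ≤ #(pool x T) * M) :
    (#A + 1 - t) ^ t * (n ^ M) ^ t ≤
      #((univ : Finset (Fin t → Fin M → Fin n)).filter fun c => ∃ T ⊆ A, run x c t = some T) *
        ∏ i ∈ range t, (2 * B i) := by
  classical
  set U := (univ : Finset (Fin t → Fin n)).filter fun u => Function.Injective u ∧ ∀ j, u j ∈ A with hU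
  set E : (Fin t → Fin n) → Finset (Fin t → Fin M → Fin n) := fun u =>
    (univ : Finset (Fin t → Fin M → Fin n)).filter fun c =>
      ∀ i : Fin t, firstHit (c i) (pool x ((univ.filter fun j : Fin t => j.1 < i.1).image u)) = some (u i) with hE
  set P : ℕ := ∏ i ∈ range t, (2 * B i) with hP
  -- each threading set is large
  have hEu : ∀ u ∈ U, (n ^ M) ^ t ≤ #(E u) * P := by
    intro u hu
    obtain ⟨hinj, hA⟩ := (mem_filter.1 hu).2
    rw [hE, card_thread, hP, ← Fin.prod_univ_eq_prod_range (fun i => 2 * B i) t, ← prod_mul_distrib,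
      ← Fin.prod_const t (n ^ M)]
    refine prod_le_prod' fun i _ => ?_
    set T := (univ.filter fun j : Fin t => j.1 < i.1).image u with hT
    have hTA : T ⊆ A := image_prefix_subset hA i.1
    have hTcard : #T = i.1 := card_image_prefix hinj (le_of_lt i.2)
    have hTlt : #T < t := by rw [hTcard]; exact i.2
    have hui : u i ∈ pool x T := hclique T hTA (u i) (hA i) (not_mem_image_prefix hinj i)
    have hge := card_firstHit_ge (M := M) (pool x T) hui (hM T hTA hTlt)
    have hBi : 2 * #(pool x T) ≤ 2 * B i.1 := by
      have := hB T hTA hTlt; rw [hTcard] at this; omega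
    calc n ^ M ≤ 2 * #(pool x T) * #((univ : Finset (Fin M → Fin n)).filter fun ci => firstHit ci (pool x T) = some (u i)) := hge
      _ ≤ 2 * B i.1 * #((univ : Finset (Fin M → Fin n)).filter fun ci => firstHit ci (pool x T) = some (u i)) :=
          Nat.mul_le_mul_right _ hBi
      _ = #((univ : Finset (Fin M → Fin n)).filter fun ci => firstHit ci (pool x T) = some (u i)) * (2 * B i.1) := by ring
  -- the threading sets are disjoint and made of tables whose run succeeds inside `A`
  have hsub : U.biUnion E ⊆ (univ : Finset (Fin t → Fin M → Fin n)).filter fun c => ∃ T ⊆ A, run x c t = some T := by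
    intro c hc
    obtain ⟨u, hu, hcu⟩ := mem_biUnion.1 hc
    obtain ⟨-, hA⟩ := (mem_filter.1 hu).2
    rw [hE, mem_filter] at hcu
    refine mem_filter.2 ⟨mem_univ _, (univ.filter fun j : Fin t => j.1 < t).image u, image_prefix_subset hA t, ?_⟩
    exact run_eq_of_thread x c u hcu.2 le_rfl
  have hdisj : (U : Set (Fin t → Fin n)).PairwiseDisjoint E := fun u _ u' _ huu' => disjoint_thread x huu'
  have hcardU := descFactorial_le_card_injective A t
  rw [← hU] at hcardU
  calc (#A + 1 - t) ^ t * (n ^ M) ^ t ≤ #U * (n ^ M) ^ t := Nat.mul_le_mul_right _ hcardU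
    _ = ∑ u ∈ U, (n ^ M) ^ t := by rw [sum_const, smul_eq_mul]
    _ ≤ ∑ u ∈ U, #(E u) * P := sum_le_sum hEu
    _ = (∑ u ∈ U, #(E u)) * P := by rw [sum_mul]
    _ = #(U.biUnion E) * P := by rw [card_biUnion hdisj]
    _ ≤ #((univ : Finset (Fin t → Fin M → Fin n)).filter fun c => ∃ T ⊆ A, run x c t = some T) * P :=
        Nat.mul_le_mul_right _ (card_le_card hsub)

end Summit.PneNP.PneNP.Theorems.MonotoneSuffices.Greedy

namespace Summit.PneNP.PneNP.Theorems.MonotoneSuffices.Greedy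

open Finset

/-- Registered sub-goal `greedy_paths` of stmt-PneNP-18026 (greedy detector, part 2): the threading count,
exported verbatim. [folklore] -/
theorem greedy_paths :
    ∀ {n t M : ℕ} (x : Literature.Probability.RandomGraphs.PlantedClique.EdgeVec n) (A : Finset (Fin n)) (B : ℕ → ℕ), (∀ T ⊆ A, ∀ v ∈ A, v ∉ T → v ∈ Summit.PneNP.PneNP.Theorems.MonotoneSuffices.Greedy.pool x T) → (∀ T ⊆ A, #T < t → #(Summit.PneNP.PneNP.Theorems.MonotoneSuffices.Greedy.pool x T) ≤ B #T) → (∀ T ⊆ A, #T < t → n ≤ #(Summit.PneNP.PneNP.Theorems.MonotoneSuffices.Greedy.pool x T) * M) → (#A + 1 - t) ^ t * (n ^ M) ^ t ≤ #((Finset.univ : Finset (Fin t → Fin M → Fin n)).filter fun c => ∃ T ⊆ A, Summit.PneNP.PneNP.Theorems.MonotoneSuffices.Greedy.run x c t = some T) * ∏ i ∈ Finset.range t, (2 * B i) :=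
  fun x A B hclique hB hM => card_runs_into_mul_ge x A B hclique hB hM

end Summit.PneNP.PneNP.Theorems.MonotoneSuffices.Greedy
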